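import Literature.AlgebraicGeometry.AbelianSchemes.PolarizedLevelPushforwardDetClass
import Literature.AlgebraicGeometry.ModuliOfAbelianVarieties.SiegelFramedCovariantUnique
import Literature.AlgebraicGeometry.ModuliOfAbelianVarieties.SiegelFramedCovariantOfHilb
import Literature.AlgebraicGeometry.ModuliOfAbelianVarieties.SiegelFramedCovariantOfHilbPrint
import Literature.AlgebraicGeometry.AbelianSchemes.MFKSubfunctorOfHilbIntrinsic
import Literature.AlgebraicGeometry.ModuliOfAbelianVarieties.SiegelFramedCovariantPlucker
import Literature.AlgebraicGeometry.ModuliOfAbelianVarieties.SiegelLinearRigidificationFrameClasses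
import Literature.AlgebraicGeometry.ModuliOfAbelianVarieties.SiegelHilbertBaseWithSections
import Literature.AlgebraicGeometry.Motives.HilbertImagePluckerClass
import Literature.AlgebraicGeometry.Motives.HilbertImageInGrassmannianUniversalFamily
import Literature.AlgebraicGeometry.Motives.GrassmannianUniversalChartData
import Literature.AlgebraicGeometry.Modules.SerreTwistTrivial
import HarnessLib

/-!
# F-13 sub-line `F13PluckerProducer` — the IMPORTABLE TWIN of the CLOSED line (ed. 1 (over Lines v1.4 ede89b42)): `stub_PL` of registry 24835 FROM THE CORES

HC_CM is proved only modulo the 7 printed citations until rung 0 closes; nothing in this file is about HC.  Cell `hodgecm-mathlib`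
(D-0151 ∕ D-0183), floor-0 line P1, sub-programme P1d; typed by F0-typ2 (g0) on F0P1d-plan (g0)'s DESK RULING 23:14:15Z under B-plan1 (g20)'s
EDITION-BOOK RULING 23:10:50Z road (ii): `Cruxes/…/Lines/*.lean` workfiles are never built into oleans, so the P1 head
`Cruxes/HDel/Lines/F0_SiegelModuli.lean` folds its letter `stub_PL` by importing THIS Theorems module —
`theorem stub_PL : ‹letter› := F13PluckerProducer.stub_PL_of_cores_holds stub_II stub_F3`.

This file is the registered line `Summits/HodgeConjecture/HodgeConjecture/Cruxes/HDel/Lines/F13PluckerProducer.lean` (skeleton v1.4, F0-typ2 (g0);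
head `stub_PL_of_cores`) CUT BY PASTE over its ten ★ `Literature` imports: the head statement is that head's statement TOKEN FOR TOKEN — binders
`hII` ≡ registry `stub_II` ([MumfordFogartyKirwan1994] Thm. 6.14 with the group law as data), `hF3` ≡ registry `stub_F3` (Cor. 6.8 Zariski-locally),
conclusion ≡ registry `stub_PL` (v5.5-C: the Plücker letter `SiegelFramedCovariant.PL` of every linearly rigidified covariant, Prop. 7.4) — renamed
`stub_PL_of_cores_holds` (FQN-clash rule, B-p02 (g17) 23:03:39Z: a Theorems twin never re-declares a name the registered Lines file owns); the body
is the line's composition verbatim with its three CLOSED stubs INLINED: P2b `stub_PLhilbClass` = ★ `Literature.AlgebraicGeometry.Motives.hilbertPluckerClass`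
(B-p11 (g20), p791887), P4 `stub_PLofHilbertBase` = ★ `Literature.AlgebraicGeometry.ModuliOfAbelianVarieties.SiegelFramedCovariant.pl_of_hilbertBase`
(B-p11 (g20), p793571), and P3 `stub_PLunitCocycle` re-homed below as `PLClosure.unitCocycle` (its 8-line body over ★
`PolarizedAbelianSchemeWithLevel.IsLinearRigidification.frameClasses`, B-p11 (g20), p790778).  Road: ⑦b∕⑦c with the Hilbert–Plücker class
(`hilbertPluckerClass`) → ★ R-C1 ED. 2 §3 explicit Hilbert base with `2g+1` sections (`hilbertBase_with_sections_explicit`) → R-C2 (A)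
`exists_siegelFramedCovariant_of_hilbertBase` FROM THE CORES → the frame classes (`PLClosure.unitCocycle`) → Prop. 7.4 for the produced covariant
(`pl_of_hilbertBase`) → transport along the classifying isomorphism (P0 `SiegelFramedCovariant.pl_of_exists_pl`).  No `def`, no `instance`,
no `notation`, no `axiom`, no `sorry`; `--axioms …stub_PL_of_cores_holds` = {propext, Classical.choice, Quot.sound}.

EDITION 2 (Q7, F0-typ2 (g0); F-4 lead memo `EDITION-SET-beta-gamma` row 11, registry card v5.6 `stub_II` := hII″): + `import …SiegelFramedCovariantOfHilbPrint`
(★ p795526: R-C2′ (A′) `exists_siegelFramedCovariant_of_hilbertBase'` over the print-exact cores) + ★ `MFKSubfunctorOfHilbIntrinsic`; NEW primed head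
`stub_PL_of_cores_holds'` whose binder `hII` is the SERVED letter `∀ (g : ℕ)` + hII″ = the statement of tree `…Cruxes.HypDel.F4LinearRigidificationII.stub_IIrep'`
([MumfordFogartyKirwan1994] Prop. 6.16 ∕ Thm. 6.14 representability half for PROJECTIVE `p₁`, no closedness conjunct), `hF3` and the conclusion unchanged,
composition = ed. 1's with hF3′ («projective ⇒ dual pair», Ch. 0 §5 (d) + Cor. 6.8) derived from `hF3` on the trivial Zariski cover and R-C2′ (A′) in place
of R-C2 (A) — a pure INSERTION: the ed.-1 theorems `stub_PL_of_cores_holds` (old v5.5-C `stub_II` letter: proper `p₁` + `IsClosed`; consumed by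
registry v5.6 Q-PL and the P1 head ED. 1.3) and `PLClosure.unitCocycle` are KEPT BYTE-IDENTICAL (director g14 s389).  Both heads TRIO, 0 sorry.

## References
[MumfordFogartyKirwan1994] D. Mumford, J. Fogarty, F. Kirwan, Geometric Invariant Theory, 3rd ed., Springer 1994 — Ch. 7 §2 Prop. 7.4 (p. 135),
Prop. 7.3 (p. 132), Def. 7.5 (p. 130), §7.2 (*) (p. 131); Ch. 6 §2 Prop. 6.13 (p. 123), §3 Thm. 6.14 (p. 124), §1 Cor. 6.8 (p. 118); Ch. 0 §5 (c) (p. 23).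
-/

noncomputable section

-- Mathlib's `Over`/pull-back API and `Scheme.Modules` section API are stated across semireducible wrappers (as in the line file).
set_option backward.isDefEq.respectTransparency false

namespace Summit.HodgeConjecture.CorCM.Cruxes.HypDel.F13PluckerProducer

open CategoryTheory CategoryTheory.Limits AlgebraicGeometry TopologicalSpace
open Polynomial
open Literature.Algebra.Homology.LaurentCech (regularityBound)
open Literature.AlgebraicGeometry.AbelianSchemes Literature.AlgebraicGeometry.AbelianSchemes.AbelianSchemeOver
  Literature.AlgebraicGeometry.AbelianSchemes.PolarizedAbelianSchemeWithLevel
  Literature.AlgebraicGeometry.Motives Literature.AlgebraicGeometry.Motives.GeneratingSections Literature.AlgebraicGeometry.Motives.Grassmannian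
  Literature.AlgebraicGeometry.Modules Literature.AlgebraicGeometry.Modules.SerreTwist
  Literature.AlgebraicGeometry.Morphisms Literature.AlgebraicGeometry.ModuliOfAbelianVarieties Literature.AlgebraicGeometry.RelativeSpec

namespace PLClosure

/-- **P3 of the line, re-homed: the FRAME CLASSES of a linear rigidification, `(m+1)`-th powers, `[U]` eliminated** — for a linearly
rigidified triple `(P, ι)` over a locally Noetherian `ℚ`-scheme with `#J + 1 = 6^g·d` and `Gr = (1, λ)`: (c2′) for each of the `2g+1` marked
sections `σₐ`, `[σₐ^*ι^*𝒪(1)]^{m+1} = [σₐ^* L^Δ(λ)]^{e₁} · [det π_*L^Δ(λ)^{⊗3}]^{e₂}` for some `e₁ e₂ : ℤ`, and (c3′) for `d ≥ 1`,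
`[det π_* ι^*𝒪(d)]^{m+1} = [det π_*(L^Δ)^{3d}]^{e₁} · [det π_*(L^Δ)^{3}]^{e₂}`; = the line's `stub_PLunitCocycle` letter token for token, body verbatim
(★ `PolarizedAbelianSchemeWithLevel.IsLinearRigidification.frameClasses` at the marked sections). [MODULI-STANDARD (GIT) ∕ print-DERIVED]
[cite: MumfordFogartyKirwan1994, Ch. 7 §2 Definition 7.5 (p. 130), §7.2 (*) (p. 131); Ch. 6 §2 Proposition 6.13 (ii)(iv) (p. 123)] -/
theorem unitCocycle : ∀ ⦃g N : ℕ⦄ ⦃δ : Fin g → ℕ⦄ ⦃J : Type⦄ [Finite J] ⦃T : Scheme.{0}⦄ [IsLocallyNoetherian T]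
    (_πT : T ⟶ Spec (.of ℚ)) (P : PolarizedAbelianSchemeWithLevel g N δ T) (ι : P.A.X.left ⟶ projectiveSpaceInt J),
    P.IsLinearRigidification J ι → Nat.card J + 1 = 6 ^ g * polarizationDegree δ →
    ∀ (Gr : P.A.X.left ⟶ P.A.prodLeft P.D.hat) (_ : Gr ≫ pullback.fst P.A.X.hom P.D.hat.X.hom = 𝟙 _)
      (_ : Gr ≫ pullback.snd P.A.X.hom P.D.hat.X.hom = P.pol.lam.left),
    (∀ a : Option (Fin g ⊕ Fin g),
      ∃ (h₃ : IsFiniteLocallyFree ((Scheme.Modules.pushforward P.A.X.hom).obj (tensorPow ((Scheme.Modules.pullback Gr).obj P.D.P) 3)))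
        (e₁ e₂ : ℤ),
        detClass (SerreTwist.isFiniteLocallyFree_serreTwist (P.markedSection a ≫ ι) 1) ^ (Nat.card J + 1) =
          detClass (P.isFiniteLocallyFree_markedSectionPullback_LDelta Gr a) ^ e₁ * detClass h₃ ^ e₂) ∧
    (∀ (d : ℕ), 0 < d →
      ∃ (hd : IsFiniteLocallyFree ((Scheme.Modules.pushforward P.A.X.hom).obj (SerreTwist.twistMod ι (unitModule P.A.X.left) d)))
        (h₃d : IsFiniteLocallyFree ((Scheme.Modules.pushforward P.A.X.hom).obj (tensorPow ((Scheme.Modules.pullback Gr).obj P.D.P) (3 * d))))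
        (h₃ : IsFiniteLocallyFree ((Scheme.Modules.pushforward P.A.X.hom).obj (tensorPow ((Scheme.Modules.pullback Gr).obj P.D.P) 3)))
        (e₁ e₂ : ℤ),
        detClass hd ^ (Nat.card J + 1) = detClass h₃d ^ e₁ * detClass h₃ ^ e₂) := by
  intro g N δ J _ T _ πT P ι hι hJ Gr hGr₁ hGr₂
  -- B-p11 (g20): the generic frame classes, at the marked sections (each a section of `π`: the unit, or a level section)
  have h := PolarizedAbelianSchemeWithLevel.IsLinearRigidification.frameClasses πT P ι hι hJ Gr hGr₁ hGr₂
  exact ⟨fun a => h.1 (P.markedSection a)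
      (by cases a with
          | none => exact P.A.unitSection_comp_hom
          | some i => exact Over.w (P.level.σ i))
      (P.isFiniteLocallyFree_markedSectionPullback_LDelta Gr a), h.2⟩

end PLClosure

/-- **`stub_PL_of_cores_holds` — the registry-24835 v5.5-C letter `stub_PL` PROVED from the registry letters `stub_II` and `stub_F3` taken as
binders VERBATIM** (statement = the registered line head `F13PluckerProducer.stub_PL_of_cores` token for token): every
`𝓗 : SiegelFramedCovariant g N δ J` locally of finite type over `ℚ` (`0 < g`, `N ≥ 3`, `#J + 1 = 6^g·d`) satisfies ★ `SiegelFramedCovariant.PL` —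
`H` quasi-compact, IMMERSED `ι_H : H → 𝐏^r_ℚ` over its structure map, the class of `ι_H^*𝒪(m)` an integer combination of the determinants
`[det π_*(L^Δ(λ)^{⊗k})]` and of the section classes `[sec_a^*L^Δ(λ)]` ([MumfordFogartyKirwan1994] Prop. 7.4: existence of `ι_H`; the identity =
the intrinsic form of the `PGL(m+1)`-linearisation, §7.2 (*), Def. 7.5, Prop. 6.13).  Binders: `hII` = Thm. 6.14 with the group law as data
(registry CORE II), `hF3` = Cor. 6.8 Zariski-locally (registry CORE F3). [MODULI-STANDARD (GIT)]
[cite: MumfordFogartyKirwan1994, Ch. 7 §2 Proposition 7.4 (p. 135), Proposition 7.3 (p. 132), Definition 7.5 (p. 130), §7.2 (*) (p. 131)]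
[cite: MumfordFogartyKirwan1994, Ch. 6 §2 Proposition 6.13 (ii)(iv) (p. 123); §3 Theorem 6.14 (p. 124); §1 Corollary 6.8 (p. 118)] -/
theorem stub_PL_of_cores_holds
    (hII : ∀ (g : ℕ) ⦃H₁ Z₁ : Scheme.{0}⦄ (p₁ : Z₁ ⟶ H₁) [IsProper p₁] [Smooth p₁] [GeometricallyConnected p₁]
      (f₁ : H₁ ⟶ Spec (.of ℚ)) [LocallyOfFiniteType f₁] (ε₁ : H₁ ⟶ Z₁) (_ : ε₁ ≫ p₁ = 𝟙 H₁),
      ∃ (H₂ : Scheme.{0}) (j₂ : H₂ ⟶ H₁) (_ : IsOpenImmersion j₂) (_ : IsClosed (Set.range j₂))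
      (G : GrpObj (Over.mk (pullback.snd p₁ j₂))),
        (@MonObj.one _ _ _ (Over.mk (pullback.snd p₁ j₂)) G.toMonObj).left ≫ pullback.fst p₁ j₂ = j₂ ≫ ε₁ ∧
        SmoothOfRelativeDimension g (pullback.snd p₁ j₂) ∧
        ∀ ⦃T : Scheme.{0}⦄ (v : T ⟶ H₁),
          (∃! w : T ⟶ H₂, w ≫ j₂ = v) ↔
            ∃ G' : GrpObj (Over.mk (pullback.snd p₁ v)),
              (@MonObj.one _ _ _ (Over.mk (pullback.snd p₁ v)) G'.toMonObj).left ≫ pullback.fst p₁ v = v ≫ ε₁ ∧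
              SmoothOfRelativeDimension g (pullback.snd p₁ v))
    (hF3 : ∀ ⦃S : Scheme.{0}⦄ [IsLocallyNoetherian S] (_fS : S ⟶ Spec (.of ℚ)) (A : AbelianSchemeOver S),
      (∀ s : S, ∃ (U : Scheme.{0}) (i : U ⟶ S) (_ : IsOpenImmersion i) (_ : s ∈ Set.range i.base)
        (B : AbelianSchemeOver U) (G : B.X.left ⟶ A.X.left), B.IsBaseChangeVia A i G ∧ IsProjective B.X.hom) →
      Nonempty A.DualPair) :
    ∀ ⦃g N : ℕ⦄ ⦃δ : Fin g → ℕ⦄ ⦃J : Type⦄ [Finite J], 0 < g → IsPolarizationType δ → 3 ≤ N →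
      Nat.card J + 1 = 6 ^ g * polarizationDegree δ →
      ∀ 𝓗 : SiegelFramedCovariant g N δ J, LocallyOfFiniteType 𝓗.H.hom → 𝓗.PL := by
  intro g N δ J _ hg hδ hN hJ 𝓗 _
  classical
  have hd1 : 1 ≤ polarizationDegree δ := Finset.prod_pos fun i _ ↦ hδ.1 i
  have hn : 1 ≤ Nat.card J := by
    have h6 : 6 ≤ 6 ^ g := by
      calc (6 : ℕ) = 6 ^ 1 := (pow_one 6).symm
        _ ≤ 6 ^ g := Nat.pow_le_pow_right (by norm_num) hg
    have h66 : 6 * 1 ≤ 6 ^ g * polarizationDegree δ := Nat.mul_le_mul h6 hd1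
    omega
  have hN0 : N ≠ 0 := by omega
  -- P2b = ★ `hilbertPluckerClass`: the closed Hilbert scheme `Hilb^{(6^g d)X^g}(𝐏^J) ↪ Gr` with its universal family AND the Hilbert–Plücker class
  obtain ⟨d, k, e₀, he₀, -, h1d, hreg, hrep, H₁, j, hj, hH₁, ZH, iH, hiH, ⟨hflat, hrank⟩, ⟨hQ, hP, hQP⟩, huniv⟩ :=
    Literature.AlgebraicGeometry.Motives.hilbertPluckerClass hn (Polynomial.C ((6 : ℚ) ^ g * polarizationDegree δ) * Polynomial.X ^ g) 1
      (fun e => (6 * e) ^ g * polarizationDegree δ)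
      (fun e _ => by push_cast; simp [Polynomial.eval_mul, Polynomial.eval_pow, Polynomial.eval_C, Polynomial.eval_X, mul_pow]; ring)
  haveI := hrep
  haveI := hj
  haveI := hiH
  haveI := hflat
  haveI := hH₁
  -- the Hilbert scheme is locally of finite type over `ℤ` (immersion into the Grassmannian, ★ `GrassmannianSchemeProper`)
  haveI : LocallyOfFiniteType (terminal.from H₁) := by
    rw [← terminal.comp_from j]
    haveI := Grassmannian.locallyOfFiniteType_terminal_from ((Fin d → Fin (Nat.card J + 1)) →₀ ℤ) k
    infer_instance
  -- ★ R-C1 ED. 2 §3: the EXPLICIT raw base `H₀ := (Z′)^{(2g+1)}_{H₁′}` with its universal family and tautological sections (instance facts §3.1)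
  let eι : Option (Fin g ⊕ Fin g) ≃ Fin (Fintype.card (Option (Fin g ⊕ Fin g))) := Fintype.equivFin _
  haveI := locallyOfFiniteType_hilbertBase iH (Spec (.of ℚ)) (Fintype.card (Option (Fin g ⊕ Fin g)))
  haveI := isClosedImmersion_hilbertBaseFamily_lift iH (Spec (.of ℚ)) (Fintype.card (Option (Fin g ⊕ Fin g)))
  haveI := flat_hilbertBaseFamily_snd iH (Spec (.of ℚ)) (Fintype.card (Option (Fin g ⊕ Fin g)))
  -- R-C2 (A): the produced covariant `𝓗₀ ↪ H₀` with its exports, FROM THE CORES `hII g`, `hF3`, at the explicit terms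
  obtain ⟨𝓗₀, jH, hjH, prH, hH, hsq, hemb, hε, hσ, hlft⟩ :=
    exists_siegelFramedCovariant_of_hilbertBase hN0 hδ hJ he₀
      (powOver.base (pullback.snd iH (projectiveSpaceMap J (pullback.fst (terminal.from H₁) (terminal.from (Spec (.of ℚ))))) ≫ projectiveSpaceFst J (pullback (terminal.from H₁) (terminal.from (Spec (.of ℚ))))) (Fintype.card (Option (Fin g ⊕ Fin g))) ≫ pullback.snd (terminal.from H₁) (terminal.from (Spec (.of ℚ))))
      (pullback.snd (pullback.snd iH (projectiveSpaceMap J (pullback.fst (terminal.from H₁) (terminal.from (Spec (.of ℚ))))) ≫ projectiveSpaceFst J (pullback (terminal.from H₁) (terminal.from (Spec (.of ℚ))))) (powOver.base (pullback.snd iH (projectiveSpaceMap J (pullback.fst (terminal.from H₁) (terminal.from (Spec (.of ℚ))))) ≫ projectiveSpaceFst J (pullback (terminal.from H₁) (terminal.from (Spec (.of ℚ))))) (Fintype.card (Option (Fin g ⊕ Fin g)))))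
      (pullback.lift (pullback.snd (pullback.snd iH (projectiveSpaceMap J (pullback.fst (terminal.from H₁) (terminal.from (Spec (.of ℚ))))) ≫ projectiveSpaceFst J (pullback (terminal.from H₁) (terminal.from (Spec (.of ℚ))))) (powOver.base (pullback.snd iH (projectiveSpaceMap J (pullback.fst (terminal.from H₁) (terminal.from (Spec (.of ℚ))))) ≫ projectiveSpaceFst J (pullback (terminal.from H₁) (terminal.from (Spec (.of ℚ))))) (Fintype.card (Option (Fin g ⊕ Fin g))))) (pullback.fst (pullback.snd iH (projectiveSpaceMap J (pullback.fst (terminal.from H₁) (terminal.from (Spec (.of ℚ))))) ≫ projectiveSpaceFst J (pullback (terminal.from H₁) (terminal.from (Spec (.of ℚ))))) (powOver.base (pullback.snd iH (projectiveSpaceMap J (pullback.fst (terminal.from H₁) (terminal.from (Spec (.of ℚ))))) ≫ projectiveSpaceFst J (pullback (terminal.from H₁) (terminal.from (Spec (.of ℚ))))) (Fintype.card (Option (Fin g ⊕ Fin g)))) ≫ pullback.snd iH (projectiveSpaceMap J (pullback.fst (terminal.from H₁) (terminal.from (Spec (.of ℚ))))) ≫ pullback.snd (terminal.from (pullback (terminal.from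 H₁) (terminal.from (Spec (.of ℚ))))) (terminal.from (projectiveSpaceInt J))) (terminal.hom_ext _ _))
      (hilbertBaseFamily_lift_comp_fst iH (Spec (.of ℚ)) (Fintype.card (Option (Fin g ⊕ Fin g)))) eι
      (fun k => pullback.lift (WidePullback.π (fun _ : Fin (Fintype.card (Option (Fin g ⊕ Fin g))) => pullback.snd iH (projectiveSpaceMap J (pullback.fst (terminal.from H₁) (terminal.from (Spec (.of ℚ))))) ≫ projectiveSpaceFst J (pullback (terminal.from H₁) (terminal.from (Spec (.of ℚ))))) k) (𝟙 (powOver (pullback.snd iH (projectiveSpaceMap J (pullback.fst (terminal.from H₁) (terminal.from (Spec (.of ℚ))))) ≫ projectiveSpaceFst J (pullback (terminal.from H₁) (terminal.from (Spec (.of ℚ))))) (Fintype.card (Option (Fin g ⊕ Fin g))))) (by rw [WidePullback.π_arrow, Category.id_comp]))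
      (fun k => lift_π_id_comp_snd (pullback.snd iH (projectiveSpaceMap J (pullback.fst (terminal.from H₁) (terminal.from (Spec (.of ℚ))))) ≫ projectiveSpaceFst J (pullback (terminal.from H₁) (terminal.from (Spec (.of ℚ))))) (Fin (Fintype.card (Option (Fin g ⊕ Fin g)))) k)
      (hilbertBase_with_sections_explicit
        (fun T X (i : X ⟶ projectiveSpace J T) => ∀ e, e₀ ≤ e →
        HasRank ((Scheme.Modules.pushforward (i ≫ projectiveSpaceFst J T)).obj
          (SerreTwist.twistMod (i ≫ pullback.snd (terminal.from T) (terminal.from (projectiveSpaceInt J))) (unitModule X) e))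
          ((6 * e) ^ g * polarizationDegree δ))
        iH huniv (Spec (.of ℚ)) (Fintype.card (Option (Fin g ⊕ Fin g))))
      (hII g) hF3
  haveI := hjH
  haveI := 𝓗₀.isLocallyNoetherian
  -- P3 = `PLClosure.unitCocycle` at the universal rigidification `(𝓗₀.univ, 𝓗₀.emb)`, graph datum `Gr = (1, λ)`
  let Gr : 𝓗₀.univ.A.X.left ⟶ 𝓗₀.univ.A.prodLeft 𝓗₀.univ.D.hat :=
    pullback.lift (𝟙 _) 𝓗₀.univ.pol.lam.left (by rw [Category.id_comp, Over.w])
  have hGr₁ : Gr ≫ pullback.fst 𝓗₀.univ.A.X.hom 𝓗₀.univ.D.hat.X.hom = 𝟙 _ := pullback.lift_fst _ _ _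
  have hGr₂ : Gr ≫ pullback.snd 𝓗₀.univ.A.X.hom 𝓗₀.univ.D.hat.X.hom = 𝓗₀.univ.pol.lam.left := pullback.lift_snd _ _ _
  obtain ⟨hc2, hc3⟩ := PLClosure.unitCocycle 𝓗₀.H.hom 𝓗₀.univ 𝓗₀.emb 𝓗₀.isLinearRigidification_emb hJ Gr hGr₁ hGr₂
  -- P4 = ★ `SiegelFramedCovariant.pl_of_hilbertBase` (assembly) for `𝓗₀`, then P0 transports `PL` to the given `𝓗`
  exact SiegelFramedCovariant.pl_of_exists_pl
    ⟨𝓗₀, Literature.AlgebraicGeometry.ModuliOfAbelianVarieties.SiegelFramedCovariant.pl_of_hilbertBase hg hδ hN0 hJ d k e₀ he₀ h1d hreg j iH hrank hQ hP hQP huniv eι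
      𝓗₀ jH prH hH hsq hemb hε hσ hlft Gr hGr₁ hGr₂ hc2 hc3⟩ 𝓗

/-- **`stub_PL_of_cores_holds'` (ED. 2, Q7) — the registry-24835 letter `stub_PL` PROVED from the SERVED core letters: `stub_II` in its v5.6 form
(`∀ g` + hII″: [MumfordFogartyKirwan1994] Thm. 6.14 ∕ Prop. 6.16 for PROJECTIVE `p₁`, no closedness conjunct — the statement of tree
`F4LinearRigidificationII.stub_IIrep'`) and `stub_F3` (v5.5-C), taken as binders VERBATIM** (statement = the line head `F13PluckerProducer.stub_PL_of_cores`
of the Q7 line edition token for token; road: hF3′ from `hF3` on the trivial cover, then R-C2′ (A′) `exists_siegelFramedCovariant_of_hilbertBase'`): every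
`𝓗 : SiegelFramedCovariant g N δ J` locally of finite type over `ℚ` (`0 < g`, `N ≥ 3`, `#J + 1 = 6^g·d`) satisfies ★ `SiegelFramedCovariant.PL` —
`H` quasi-compact, IMMERSED `ι_H : H → 𝐏^r_ℚ` over its structure map, the class of `ι_H^*𝒪(m)` an integer combination of the determinants
`[det π_*(L^Δ(λ)^{⊗k})]` and of the section classes `[sec_a^*L^Δ(λ)]` ([MumfordFogartyKirwan1994] Prop. 7.4: existence of `ι_H`; the identity =
the intrinsic form of the `PGL(m+1)`-linearisation, §7.2 (*), Def. 7.5, Prop. 6.13).  Binders: `hII` = Thm. 6.14 ∕ Prop. 6.16 (projective `p₁`) with the group law as data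
(registry CORE II, v5.6), `hF3` = Cor. 6.8 Zariski-locally (registry CORE F3). [MODULI-STANDARD (GIT)]
[cite: MumfordFogartyKirwan1994, Ch. 7 §2 Proposition 7.4 (p. 135), Proposition 7.3 (p. 132), Definition 7.5 (p. 130), §7.2 (*) (p. 131)]
[cite: MumfordFogartyKirwan1994, Ch. 6 §2 Proposition 6.13 (ii)(iv) (p. 123); §3 Theorem 6.14 (p. 124); §1 Corollary 6.8 (p. 118)] -/
theorem stub_PL_of_cores_holds'
    (hII : ∀ (g : ℕ) ⦃H₁ Z₁ : Scheme.{0}⦄ (p₁ : Z₁ ⟶ H₁) [IsProper p₁] [Smooth p₁] [GeometricallyConnected p₁]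
      (_ : IsProjective p₁)
      (f₁ : H₁ ⟶ Spec (.of ℚ)) [LocallyOfFiniteType f₁] (ε₁ : H₁ ⟶ Z₁) (_ : ε₁ ≫ p₁ = 𝟙 H₁),
      ∃ (H₂ : Scheme.{0}) (j₂ : H₂ ⟶ H₁) (_ : IsOpenImmersion j₂)
      (G : GrpObj (Over.mk (pullback.snd p₁ j₂))),
        (@MonObj.one _ _ _ (Over.mk (pullback.snd p₁ j₂)) G.toMonObj).left ≫ pullback.fst p₁ j₂ = j₂ ≫ ε₁ ∧
        SmoothOfRelativeDimension g (pullback.snd p₁ j₂) ∧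
        ∀ ⦃T : Scheme.{0}⦄ (v : T ⟶ H₁),
          (∃! w : T ⟶ H₂, w ≫ j₂ = v) ↔
            ∃ G' : GrpObj (Over.mk (pullback.snd p₁ v)),
              (@MonObj.one _ _ _ (Over.mk (pullback.snd p₁ v)) G'.toMonObj).left ≫ pullback.fst p₁ v = v ≫ ε₁ ∧
              SmoothOfRelativeDimension g (pullback.snd p₁ v))
    (hF3 : ∀ ⦃S : Scheme.{0}⦄ [IsLocallyNoetherian S] (_fS : S ⟶ Spec (.of ℚ)) (A : AbelianSchemeOver S),
      (∀ s : S, ∃ (U : Scheme.{0}) (i : U ⟶ S) (_ : IsOpenImmersion i) (_ : s ∈ Set.range i.base)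
        (B : AbelianSchemeOver U) (G : B.X.left ⟶ A.X.left), B.IsBaseChangeVia A i G ∧ IsProjective B.X.hom) →
      Nonempty A.DualPair) :
    ∀ ⦃g N : ℕ⦄ ⦃δ : Fin g → ℕ⦄ ⦃J : Type⦄ [Finite J], 0 < g → IsPolarizationType δ → 3 ≤ N →
      Nat.card J + 1 = 6 ^ g * polarizationDegree δ →
      ∀ 𝓗 : SiegelFramedCovariant g N δ J, LocallyOfFiniteType 𝓗.H.hom → 𝓗.PL := by
  intro g N δ J _ hg hδ hN hJ 𝓗 _
  classical
  have hd1 : 1 ≤ polarizationDegree δ := Finset.prod_pos fun i _ ↦ hδ.1 i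
  have hn : 1 ≤ Nat.card J := by
    have h6 : 6 ≤ 6 ^ g := by
      calc (6 : ℕ) = 6 ^ 1 := (pow_one 6).symm
        _ ≤ 6 ^ g := Nat.pow_le_pow_right (by norm_num) hg
    have h66 : 6 * 1 ≤ 6 ^ g * polarizationDegree δ := Nat.mul_le_mul h6 hd1
    omega
  have hN0 : N ≠ 0 := by omega
  -- P2b = ★ `hilbertPluckerClass`: the closed Hilbert scheme `Hilb^{(6^g d)X^g}(𝐏^J) ↪ Gr` with its universal family AND the Hilbert–Plücker class
  obtain ⟨d, k, e₀, he₀, -, h1d, hreg, hrep, H₁, j, hj, hH₁, ZH, iH, hiH, ⟨hflat, hrank⟩, ⟨hQ, hP, hQP⟩, huniv⟩ :=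
    Literature.AlgebraicGeometry.Motives.hilbertPluckerClass hn (Polynomial.C ((6 : ℚ) ^ g * polarizationDegree δ) * Polynomial.X ^ g) 1
      (fun e => (6 * e) ^ g * polarizationDegree δ)
      (fun e _ => by push_cast; simp [Polynomial.eval_mul, Polynomial.eval_pow, Polynomial.eval_C, Polynomial.eval_X, mul_pow]; ring)
  haveI := hrep
  haveI := hj
  haveI := hiH
  haveI := hflat
  haveI := hH₁
  -- the Hilbert scheme is locally of finite type over `ℤ` (immersion into the Grassmannian, ★ `GrassmannianSchemeProper`)
  haveI : LocallyOfFiniteType (terminal.from H₁) := by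
    rw [← terminal.comp_from j]
    haveI := Grassmannian.locallyOfFiniteType_terminal_from ((Fin d → Fin (Nat.card J + 1)) →₀ ℤ) k
    infer_instance
  -- ★ R-C1 ED. 2 §3: the EXPLICIT raw base `H₀ := (Z′)^{(2g+1)}_{H₁′}` with its universal family and tautological sections (instance facts §3.1)
  let eι : Option (Fin g ⊕ Fin g) ≃ Fin (Fintype.card (Option (Fin g ⊕ Fin g))) := Fintype.equivFin _
  haveI := locallyOfFiniteType_hilbertBase iH (Spec (.of ℚ)) (Fintype.card (Option (Fin g ⊕ Fin g)))
  haveI := isClosedImmersion_hilbertBaseFamily_lift iH (Spec (.of ℚ)) (Fintype.card (Option (Fin g ⊕ Fin g)))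
  haveI := flat_hilbertBaseFamily_snd iH (Spec (.of ℚ)) (Fintype.card (Option (Fin g ⊕ Fin g)))
  -- R-C2 (A): the produced covariant `𝓗₀ ↪ H₀` with its exports, FROM THE CORES `hII g`, `hF3`, at the explicit terms
  -- Q7: R-C2′ (A′) takes the print-exact dual letter hF3′; it follows from the registry `hF3` on the trivial Zariski cover
  have hF3' : ∀ ⦃S : Scheme.{0}⦄ [IsLocallyNoetherian S] (_ : S ⟶ Spec (.of ℚ)) (A : AbelianSchemeOver S),
      IsProjective A.X.hom → Nonempty A.DualPair := fun S _ fS A hA =>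
    hF3 fS A fun s => ⟨S, 𝟙 S, inferInstance, ⟨s, rfl⟩, A, (Iso.refl A.X).hom.left,
      isBaseChangeVia_id_of_iso_of_one_comp A A (Iso.refl A.X) (Category.comp_id _), hA⟩
  obtain ⟨𝓗₀, jH, hjH, prH, hH, hsq, hemb, hε, hσ, hlft⟩ :=
    exists_siegelFramedCovariant_of_hilbertBase' hN0 hδ hJ he₀
      (powOver.base (pullback.snd iH (projectiveSpaceMap J (pullback.fst (terminal.from H₁) (terminal.from (Spec (.of ℚ))))) ≫ projectiveSpaceFst J (pullback (terminal.from H₁) (terminal.from (Spec (.of ℚ))))) (Fintype.card (Option (Fin g ⊕ Fin g))) ≫ pullback.snd (terminal.from H₁) (terminal.from (Spec (.of ℚ))))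
      (pullback.snd (pullback.snd iH (projectiveSpaceMap J (pullback.fst (terminal.from H₁) (terminal.from (Spec (.of ℚ))))) ≫ projectiveSpaceFst J (pullback (terminal.from H₁) (terminal.from (Spec (.of ℚ))))) (powOver.base (pullback.snd iH (projectiveSpaceMap J (pullback.fst (terminal.from H₁) (terminal.from (Spec (.of ℚ))))) ≫ projectiveSpaceFst J (pullback (terminal.from H₁) (terminal.from (Spec (.of ℚ))))) (Fintype.card (Option (Fin g ⊕ Fin g)))))
      (pullback.lift (pullback.snd (pullback.snd iH (projectiveSpaceMap J (pullback.fst (terminal.from H₁) (terminal.from (Spec (.of ℚ))))) ≫ projectiveSpaceFst J (pullback (terminal.from H₁) (terminal.from (Spec (.of ℚ))))) (powOver.base (pullback.snd iH (projectiveSpaceMap J (pullback.fst (terminal.from H₁) (terminal.from (Spec (.of ℚ))))) ≫ projectiveSpaceFst J (pullback (terminal.from H₁) (terminal.from (Spec (.of ℚ))))) (Fintype.card (Option (Fin g ⊕ Fin g))))) (pullback.fst (pullback.snd iH (projectiveSpaceMap J (pullback.fst (terminal.from H₁) (terminal.from (Spec (.of ℚ))))) ≫ projectiveSpaceFst J (pullback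 (terminal.from H₁) (terminal.from (Spec (.of ℚ))))) (powOver.base (pullback.snd iH (projectiveSpaceMap J (pullback.fst (terminal.from H₁) (terminal.from (Spec (.of ℚ))))) ≫ projectiveSpaceFst J (pullback (terminal.from H₁) (terminal.from (Spec (.of ℚ))))) (Fintype.card (Option (Fin g ⊕ Fin g)))) ≫ pullback.snd iH (projectiveSpaceMap J (pullback.fst (terminal.from H₁) (terminal.from (Spec (.of ℚ))))) ≫ pullback.snd (terminal.from (pullback (terminal.from H₁) (terminal.from (Spec (.of ℚ))))) (terminal.from (projectiveSpaceInt J))) (terminal.hom_ext _ _))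
      (hilbertBaseFamily_lift_comp_fst iH (Spec (.of ℚ)) (Fintype.card (Option (Fin g ⊕ Fin g)))) eι
      (fun k => pullback.lift (WidePullback.π (fun _ : Fin (Fintype.card (Option (Fin g ⊕ Fin g))) => pullback.snd iH (projectiveSpaceMap J (pullback.fst (terminal.from H₁) (terminal.from (Spec (.of ℚ))))) ≫ projectiveSpaceFst J (pullback (terminal.from H₁) (terminal.from (Spec (.of ℚ))))) k) (𝟙 (powOver (pullback.snd iH (projectiveSpaceMap J (pullback.fst (terminal.from H₁) (terminal.from (Spec (.of ℚ))))) ≫ projectiveSpaceFst J (pullback (terminal.from H₁) (terminal.from (Spec (.of ℚ))))) (Fintype.card (Option (Fin g ⊕ Fin g))))) (by rw [WidePullback.π_arrow, Category.id_comp]))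
      (fun k => lift_π_id_comp_snd (pullback.snd iH (projectiveSpaceMap J (pullback.fst (terminal.from H₁) (terminal.from (Spec (.of ℚ))))) ≫ projectiveSpaceFst J (pullback (terminal.from H₁) (terminal.from (Spec (.of ℚ))))) (Fin (Fintype.card (Option (Fin g ⊕ Fin g)))) k)
      (hilbertBase_with_sections_explicit
        (fun T X (i : X ⟶ projectiveSpace J T) => ∀ e, e₀ ≤ e →
        HasRank ((Scheme.Modules.pushforward (i ≫ projectiveSpaceFst J T)).obj
          (SerreTwist.twistMod (i ≫ pullback.snd (terminal.from T) (terminal.from (projectiveSpaceInt J))) (unitModule X) e))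
          ((6 * e) ^ g * polarizationDegree δ))
        iH huniv (Spec (.of ℚ)) (Fintype.card (Option (Fin g ⊕ Fin g))))
      (hII g) hF3'
  haveI := hjH
  haveI := 𝓗₀.isLocallyNoetherian
  -- P3 = `PLClosure.unitCocycle` at the universal rigidification `(𝓗₀.univ, 𝓗₀.emb)`, graph datum `Gr = (1, λ)`
  let Gr : 𝓗₀.univ.A.X.left ⟶ 𝓗₀.univ.A.prodLeft 𝓗₀.univ.D.hat :=
    pullback.lift (𝟙 _) 𝓗₀.univ.pol.lam.left (by rw [Category.id_comp, Over.w])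
  have hGr₁ : Gr ≫ pullback.fst 𝓗₀.univ.A.X.hom 𝓗₀.univ.D.hat.X.hom = 𝟙 _ := pullback.lift_fst _ _ _
  have hGr₂ : Gr ≫ pullback.snd 𝓗₀.univ.A.X.hom 𝓗₀.univ.D.hat.X.hom = 𝓗₀.univ.pol.lam.left := pullback.lift_snd _ _ _
  obtain ⟨hc2, hc3⟩ := PLClosure.unitCocycle 𝓗₀.H.hom 𝓗₀.univ 𝓗₀.emb 𝓗₀.isLinearRigidification_emb hJ Gr hGr₁ hGr₂
  -- P4 = ★ `SiegelFramedCovariant.pl_of_hilbertBase` (assembly) for `𝓗₀`, then P0 transports `PL` to the given `𝓗`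
  exact SiegelFramedCovariant.pl_of_exists_pl
    ⟨𝓗₀, Literature.AlgebraicGeometry.ModuliOfAbelianVarieties.SiegelFramedCovariant.pl_of_hilbertBase hg hδ hN0 hJ d k e₀ he₀ h1d hreg j iH hrank hQ hP hQP huniv eι
      𝓗₀ jH prH hH hsq hemb hε hσ hlft Gr hGr₁ hGr₂ hc2 hc3⟩ 𝓗

end Summit.HodgeConjecture.CorCM.Cruxes.HypDel.F13PluckerProducer

end
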